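import Literature.Combinatorics.Sahi2008.FKG
import Summits.CriticalPhenomena.PercolationContinuityZ3.Theorems.SahiMasterFamilyTotalCumulance
import Mathlib.Tactic.Linarith
import HarnessLib

/-!
# `NoHeavyLowerTail` (crux stmt-CriticalPhenomena-4575), Sahi programme P4 — positive association is preserved under products of weights

Support file (cell `prim-l12`, seat P4, generation 38; `--supports stmt-CriticalPhenomena-4575`).  No definitions, no named facts, no sorries;
standard axioms.

For finite preorders `γ, β` with nonnegative weights `μ, ν` (`ν` a probability weight is not even needed for the inequality, only `ν ≥ 0`;
`μ ≥ 0`), if `μ` and `ν` are Sahi-positive of order 2 (= the Harris–FKG inequality for nonnegative monotone pairs,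
`Literature…sahiPositive_two_iff_fkg`) then so is the product weight `μ ⊗ ν` on `γ × β` with the product (componentwise) preorder:
`theorem sahiPositive_two_prodWeight`.  PROOF (Esary–Proschan–Walkup's argument for association of independent unions, in covariance form):
`E_{μ⊗ν}(fg) = E_ν[y ↦ E_μ(f(·,y) g(·,y))] ≥ E_ν[y ↦ E_μ f(·,y) · E_μ g(·,y)] ≥ E_ν[E_μ f(·,y)] · E_ν[E_μ g(·,y)] = E f · E g` — Harris in `x` for each
section, then Harris in `y` for the (monotone, nonnegative) section averages.  ROLE: the lattice-level steps of the `H₄⁺`-closure programme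
(`…SahiE4UnionThreeLattice`, `…SahiE3ProdRow03UnionLattice`, `…SahiE3ProductRowUnionLattice`, …) take `SahiPositive μ 2` for the weight of
the already-assembled family `a`; to ITERATE them over several independent blocks one needs the assembled product weight to be again
Sahi-2-positive, which is this file.  HONEST FRAMING: folklore (association of independent families, Esary–Proschan–Walkup 1967, Thm. 2.1 /
Harris 1960); recorded here as bookkeeping for the closure programme, nothing in it is specific to Sahi's conjecture. [folklore]
-/

noncomputable section

namespace Summit.CriticalPhenomena.PercolationContinuityZ3.Theorems.SahiPAProduct

open Finset Literature.Combinatorics.Sahi2008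

variable {γ β : Type*} [Fintype γ] [Fintype β]

/-- **Positive association (Sahi positivity of order 2 = Harris–FKG for monotone pairs) is preserved under products of nonnegative
weights** on the componentwise-ordered product of two finite preorders. [folklore] (Esary–Proschan–Walkup 1967; Harris 1960) -/
theorem sahiPositive_two_prodWeight [Preorder γ] [Preorder β] (μ : γ → ℝ) (ν : β → ℝ)
    (hμ0 : ∀ x, 0 ≤ μ x) (hν0 : ∀ y, 0 ≤ ν y) (hμ : SahiPositive μ 2) (hν : SahiPositive ν 2) :
    SahiPositive (fun p : γ × β => μ p.1 * ν p.2) 2 := by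
  rw [sahiPositive_two_iff_fkg] at hμ hν ⊢
  intro f g hf hg hfm hgm
  -- section averages
  set F : β → ℝ := fun y => ex μ (fun x => f (x, y)) with hFdef
  set G : β → ℝ := fun y => ex μ (fun x => g (x, y)) with hGdef
  have hF0 : ∀ y, 0 ≤ F y := fun y => ex_nonneg hμ0 fun x => hf (x, y)
  have hG0 : ∀ y, 0 ≤ G y := fun y => ex_nonneg hμ0 fun x => hg (x, y)
  have hFm : Monotone F := by
    intro y y' hyy
    exact ex_mono hμ0 fun x => hfm (Prod.mk_le_mk.2 ⟨le_rfl, hyy⟩)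
  have hGm : Monotone G := by
    intro y y' hyy
    exact ex_mono hμ0 fun x => hgm (Prod.mk_le_mk.2 ⟨le_rfl, hyy⟩)
  -- Harris in `x` for each section
  have hsec : ∀ y, F y * G y ≤ ex μ (fun x => (f * g) (x, y)) := by
    intro y
    have h := hμ (fun x => f (x, y)) (fun x => g (x, y)) (fun x => hf _) (fun x => hg _)
      (fun x x' hxx => hfm (Prod.mk_le_mk.2 ⟨hxx, le_rfl⟩)) (fun x x' hxx => hgm (Prod.mk_le_mk.2 ⟨hxx, le_rfl⟩))
    have e : ((fun x => f (x, y)) * fun x => g (x, y)) = fun x => (f * g) (x, y) := by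
      funext x; simp only [Pi.mul_apply]
    rw [e] at h
    exact h
  -- Harris in `y` for the section averages
  have hy : ex ν F * ex ν G ≤ ex ν (F * G) := hν F G hF0 hG0 hFm hGm
  have hmono : ex ν (F * G) ≤ ex ν (fun y => ex μ (fun x => (f * g) (x, y))) :=
    ex_mono hν0 fun y => by simpa only [Pi.mul_apply] using hsec y
  rw [SahiTotalCumulance.ex_prod_weight μ ν f, SahiTotalCumulance.ex_prod_weight μ ν g, SahiTotalCumulance.ex_prod_weight μ ν (f * g)]
  exact le_trans hy hmono

end Summit.CriticalPhenomena.PercolationContinuityZ3.Theorems.SahiPAProduct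

end
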